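import Mathlib
import HarnessLib
import Literature.Analysis.Calculus.SpherePoincareSharp
import Summits.Ventures.LatticeQCDFlow.Exactness.RadialPolar
import Summits.Ventures.LatticeQCDFlow.Exactness.SphereSiteLaplacianCalculus
import Summits.Ventures.LatticeQCDFlow.Exactness.SphereLatticeGreen
import Summits.Ventures.LatticeQCDFlow.Exactness.LatticeEfronStein

/-!
# The spectral gap of Lüscher's operator on the lattice of spheres is `d − 1`, uniformly in the lattice size

HONEST FRAMING: exact (Metropolis-corrected) sampling algorithms for lattice gauge theory;
figures of merit are autocorrelation/cost numbers at stated couplings and volumes; no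
continuum-physics claim.

Venture `LatticeQCDFlow` (cell pub-lqcd), topic `Exactness`; FANOUT row 7 (`s0-cpn-null`: the
S0-D1 rung — 2D CP⁹, Lüscher's LO trivializing map inside HMC, Engel–Schaefer 2011).  NEW WORK of
the cell over Mathlib, the tree's `Exactness/SphereLatticeGreen.lean` (`⟨F, 𝔏₀F⟩ = Σ_k∫‖∂̃_kF‖²`),
`Exactness/LatticeEfronStein.lean` (tensorisation of variance), `Exactness/SphereSiteGreen.lean`,
`Exactness/SphereSiteLaplacianCalculus.lean`, `Exactness/RadialPolar.lean` (`uniformSphere`), and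
the Literature support file `Literature/Analysis/Calculus/SpherePoincareSharp.lean`
(`sharp_poincare_sphere`: `λ₁(S^{m−1}) = m − 1`, [folklore], typed in the tree for Waldron 2019);
nothing is cited as a fact.  Printed counterpart, NAMED ONLY: M. Lüscher, Commun. Math. Phys.
293 (2010) 899, §3.3 (the operator `𝔏₀` of the recursion for the trivializing flow action is
symmetric, non-negative, with null space the constants, hence invertible on their orthogonal
complement — here made QUANTITATIVE for the CP(N−1)/O(N) site spheres of Engel–Schaefer, Comput.
Phys. Commun. 182 (2011) 2107, §3: the inverse is bounded by `1/(d−1) = 1/(2N−1)` on mean-zero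
functions, for every lattice `Λ`).

## Setting

`𝔼 = EuclideanSpace ℝ (Fin m)`, `m ≥ 2` (CP(N−1): `m = 2N`), unit sphere `S ⊂ 𝔼` with Mathlib's
measure `σ = volume.toSphere` and its normalisation `σ̄ = uniformSphere volume`; `Λ` finite,
`π = ⊗_Λ σ̄` the uniform probability measure on the product of site spheres; `F : (Λ → 𝔼) → ℝ`
of class `C²`, read on configurations through `n ↦ (ω n : 𝔼)`; `∂̃_k`, `∂̃_k·∂̃_k` E–S's site
operators (`siteGrad`, `siteLaplacian`).

## Content

* `sphDirichlet_self_eq_integral_norm_gradient_sq`, **`sphere_poincare_toSphere`**,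
  **`sphere_poincare_uniformSphere`** — ONE SITE: for a degree-`0` extension `f ∈ C²(𝔼 ∖ 0)`,
  `(m−1)·Var_σ̄(f) ≤ ∫ ‖∇f‖² dσ̄` (the Literature's sharp Poincaré inequality read through
  `SphereSiteGreen`: its Dirichlet form is `∫‖∂̃f‖²`).
* `fibre_variance_le` — the same in the `k`-th site fibre through a configuration.
* **`lattice_sphere_poincare`** — THE LATTICE POINCARÉ INEQUALITY:
  `(m − 1)·(∫ F² dπ − (∫ F dπ)²) ≤ Σ_k ∫ ‖∂̃_k F‖² dπ` for every finite `Λ` (Efron–Stein + one site).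
* `pi_uniformSphere_eq_smul_toSphere`, `integral_pi_uniformSphere` — `π` is a rescaling of `⊗_Λ σ`;
  **`lattice_sphere_spectral_gap`** — `(m − 1)·(∫ F² dπ − (∫ F dπ)²) ≤ ∫ F·(−Σ_k ∂̃_k·∂̃_k F) dπ`:
  LÜSCHER'S OPERATOR HAS SPECTRAL GAP `≥ m − 1 = 2N − 1` ON THE LATTICE OF SPHERES, INDEPENDENTLY
  OF `|Λ|`.
* **`lattice_sphere_spectral_gap_attained`** — equality for `F(x) = ⟪a, x_k⟫` (a site-linear
  function: `𝔏₀F = (m−1)F`, `∫F dπ = 0`): the gap IS `m − 1`.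

NOT CLAIMED: a spectral theorem for `𝔏₀` (only the quadratic-form inequality on `C²` functions);
the gap for the interacting measure `e^{−S}dπ` or at `t > 0` of Lüscher's flow; decay of
`𝔏₀⁻¹` kernels (locality); anything quantitative about autocorrelations.
-/

noncomputable section

namespace Summit.Ventures.LatticeQCDFlow.Exactness

open NormedSpace Function MeasureTheory Metric InnerProductSpace Laplacian Filter Set
open Literature.Analysis.Calculus Literature.Analysis.FluidPDE
open scoped RealInnerProductSpace Topology Gradient ENNReal

/-! ## §1 One site: the sharp Poincaré inequality in Engel–Schaefer's language -/

section OneSite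

variable {m : ℕ}

/-- `𝔼 = ℝ^m` is nontrivial for `m ≥ 2`. -/
theorem nontrivial_euclideanSpace_of_two_le (hm : 2 ≤ m) : Nontrivial (EuclideanSpace ℝ (Fin m)) :=
  Module.nontrivial_of_finrank_pos (R := ℝ) (by rw [finrank_euclideanSpace, Fintype.card_fin]; omega)

/-- **The Literature's Dirichlet form is `∫ ‖∂̃f‖²`**: for a degree-`0` extension `f ∈ C²(𝔼 ∖ 0)`,
`Q₁(f, f) = ∫ ‖∇f‖² dσ` over the unit sphere. -/
theorem sphDirichlet_self_eq_integral_norm_gradient_sq (hm : 2 ≤ m)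
    {f : EuclideanSpace ℝ (Fin m) → ℝ} (hf : ContDiffOn ℝ 2 f {0}ᶜ)
    (hf0 : ∀ y, f (normalize y) = f y) :
    sphDirichlet (EuclideanSpace.basisFun (Fin m) ℝ) f f 1 =
      ∫ u : sphere (0 : EuclideanSpace ℝ (Fin m)) 1, ‖∇ f u‖ ^ 2
        ∂(volume : Measure (EuclideanSpace ℝ (Fin m))).toSphere := by
  haveI := nontrivial_euclideanSpace_of_two_le hm
  rw [sphDirichlet_eq_neg_sphereIntegral _ (hf.of_le (by norm_num)) hf one_pos,
    sphereIntegral_one_eq_integral (fun x => f x * sphLaplacian (EuclideanSpace.basisFun (Fin m) ℝ) f x)]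
  have hcongr : ∫ u : sphere (0 : EuclideanSpace ℝ (Fin m)) 1,
      f u * sphLaplacian (EuclideanSpace.basisFun (Fin m) ℝ) f u
        ∂(volume : Measure (EuclideanSpace ℝ (Fin m))).toSphere =
      ∫ u : sphere (0 : EuclideanSpace ℝ (Fin m)) 1, f u * Δ f u
        ∂(volume : Measure (EuclideanSpace ℝ (Fin m))).toSphere := by
    refine integral_congr_ae (ae_of_all _ fun u => ?_)
    have hu : ‖(u : EuclideanSpace ℝ (Fin m))‖ = 1 := norm_eq_of_mem_sphere u
    show f u * sphLaplacian (EuclideanSpace.basisFun (Fin m) ℝ) f u = f u * Δ f u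
    rw [laplacian_eq_sphLaplacian_of_comp_normalize (EuclideanSpace.basisFun (Fin m) ℝ) hf0 hu
      (hf.contDiffAt (isOpen_compl_singleton.mem_nhds (mem_compl_zero_of_norm_eq one_pos hu)))]
  rw [hcongr, integral_sphere_mul_laplacian_self hf hf0, neg_neg]

/-- **The sharp Poincaré inequality on one site sphere, for `σ = volume.toSphere`**: for a
degree-`0` extension `f ∈ C²(𝔼 ∖ 0)`, `m ≥ 2`,
`(m − 1)·(∫ f² dσ − (∫ f dσ)²/σ(S)) ≤ ∫ ‖∇f‖² dσ`. -/
theorem sphere_poincare_toSphere (hm : 2 ≤ m) {f : EuclideanSpace ℝ (Fin m) → ℝ}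
    (hf : ContDiffOn ℝ 2 f {0}ᶜ) (hf0 : ∀ y, f (normalize y) = f y) :
    ((m : ℝ) - 1) * (∫ u : sphere (0 : EuclideanSpace ℝ (Fin m)) 1, f u ^ 2
        ∂(volume : Measure (EuclideanSpace ℝ (Fin m))).toSphere -
      (∫ u : sphere (0 : EuclideanSpace ℝ (Fin m)) 1, f u
        ∂(volume : Measure (EuclideanSpace ℝ (Fin m))).toSphere) ^ 2 /
        ((volume : Measure (EuclideanSpace ℝ (Fin m))).toSphere univ).toReal) ≤
      ∫ u : sphere (0 : EuclideanSpace ℝ (Fin m)) 1, ‖∇ f u‖ ^ 2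
        ∂(volume : Measure (EuclideanSpace ℝ (Fin m))).toSphere := by
  have h := MvPoly.sharp_poincare_sphere hm hf
  rw [sphDirichlet_self_eq_integral_norm_gradient_sq hm hf hf0,
    sphereIntegral_one_eq_integral (fun x => f x ^ 2), sphereIntegral_one_eq_integral f,
    sphereIntegral_one_eq_integral (fun _ => (1 : ℝ)), integral_const, smul_eq_mul, mul_one,
    Measure.real] at h
  exact h

/-- **The sharp Poincaré inequality on one site sphere, for the uniform probability measure**
`σ̄ = uniformSphere volume` on `S^{m+1} ⊂ ℝ^{m+2}`: `(m + 1)·(∫ f² dσ̄ − (∫ f dσ̄)²) ≤ ∫ ‖∇f‖² dσ̄`. -/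
theorem sphere_poincare_uniformSphere {f : EuclideanSpace ℝ (Fin (m + 2)) → ℝ}
    (hf : ContDiffOn ℝ 2 f {0}ᶜ) (hf0 : ∀ y, f (normalize y) = f y) :
    ((m : ℝ) + 1) * (∫ u : sphere (0 : EuclideanSpace ℝ (Fin (m + 2))) 1, f u ^ 2
        ∂uniformSphere (volume : Measure (EuclideanSpace ℝ (Fin (m + 2)))) -
      (∫ u : sphere (0 : EuclideanSpace ℝ (Fin (m + 2))) 1, f u
        ∂uniformSphere (volume : Measure (EuclideanSpace ℝ (Fin (m + 2))))) ^ 2) ≤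
      ∫ u : sphere (0 : EuclideanSpace ℝ (Fin (m + 2))) 1, ‖∇ f u‖ ^ 2
        ∂uniformSphere (volume : Measure (EuclideanSpace ℝ (Fin (m + 2)))) := by
  have hm : 2 ≤ m + 2 := by omega
  have h := sphere_poincare_toSphere hm hf hf0
  have hcast : ((((m + 2 : ℕ) : ℝ)) - 1) = (m : ℝ) + 1 := by push_cast; ring
  rw [hcast] at h
  set s : ℝ := ((volume : Measure (EuclideanSpace ℝ (Fin (m + 2)))).toSphere univ).toReal with hs
  have hs0 : 0 < s := ENNReal.toReal_pos (toSphere_univ_ne_zero _) (measure_ne_top _ _)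
  simp only [uniformSphere, integral_smul_measure, ENNReal.toReal_inv, smul_eq_mul]
  rw [← hs]
  set I₂ := ∫ u : sphere (0 : EuclideanSpace ℝ (Fin (m + 2))) 1, f u ^ 2
    ∂(volume : Measure (EuclideanSpace ℝ (Fin (m + 2)))).toSphere
  set I₁ := ∫ u : sphere (0 : EuclideanSpace ℝ (Fin (m + 2))) 1, f u
    ∂(volume : Measure (EuclideanSpace ℝ (Fin (m + 2)))).toSphere
  set D := ∫ u : sphere (0 : EuclideanSpace ℝ (Fin (m + 2))) 1, ‖∇ f u‖ ^ 2
    ∂(volume : Measure (EuclideanSpace ℝ (Fin (m + 2)))).toSphere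
  have hkey : ((m : ℝ) + 1) * (s⁻¹ * I₂ - (s⁻¹ * I₁) ^ 2) =
      s⁻¹ * (((m : ℝ) + 1) * (I₂ - I₁ ^ 2 / s)) := by
    rw [div_eq_mul_inv]
    ring
  rw [hkey]
  exact mul_le_mul_of_nonneg_left h (inv_nonneg.2 hs0.le)

end OneSite

/-! ## §2 The lattice: Poincaré by tensorisation -/

section Lattice

variable {m : ℕ} {Λ : Type*} [Fintype Λ] [DecidableEq Λ]

/-- **The fibre inequality.**  In the `k`-th site fibre through `ω` (the other sites frozen), for
`F ∈ C²`: `(m−1)·(∫ F(ω[k←v])² dσ̄(v) − (∫ F(ω[k←v]) dσ̄(v))²) ≤ ∫ ‖∂̃_k F(ω[k←v])‖² dσ̄(v)` — the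
one-site inequality for the degree-`0` section `y ↦ F(ω[k ← y/‖y‖])`. -/
theorem fibre_variance_le {F : (Λ → EuclideanSpace ℝ (Fin (m + 2))) → ℝ}
    (hF : ContDiff ℝ 2 F) (k : Λ) (ω : Λ → sphere (0 : EuclideanSpace ℝ (Fin (m + 2))) 1) :
    ((m : ℝ) + 1) * (∫ v, F (fun n => ((update ω k v) n : EuclideanSpace ℝ (Fin (m + 2)))) ^ 2
        ∂uniformSphere (volume : Measure (EuclideanSpace ℝ (Fin (m + 2)))) -
      (∫ v, F (fun n => ((update ω k v) n : EuclideanSpace ℝ (Fin (m + 2))))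
        ∂uniformSphere (volume : Measure (EuclideanSpace ℝ (Fin (m + 2))))) ^ 2) ≤
      ∫ v, ‖siteGrad k F (fun n => ((update ω k v) n : EuclideanSpace ℝ (Fin (m + 2))))‖ ^ 2
        ∂uniformSphere (volume : Measure (EuclideanSpace ℝ (Fin (m + 2)))) := by
  have hf : ContDiffOn ℝ 2 (fun y : EuclideanSpace ℝ (Fin (m + 2)) =>
      F (update (fun n => (ω n : EuclideanSpace ℝ (Fin (m + 2)))) k (normalize y))) {0}ᶜ :=
    contDiffOn_comp_update_normalize hF _ k
  have hf0 : ∀ y : EuclideanSpace ℝ (Fin (m + 2)), (fun y : EuclideanSpace ℝ (Fin (m + 2)) =>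
      F (update (fun n => (ω n : EuclideanSpace ℝ (Fin (m + 2)))) k (normalize y))) (normalize y) =
      (fun y : EuclideanSpace ℝ (Fin (m + 2)) =>
        F (update (fun n => (ω n : EuclideanSpace ℝ (Fin (m + 2)))) k (normalize y))) y := fun y => by
    simp only [normalize_normalize]
  have h := sphere_poincare_uniformSphere hf hf0
  have hν : ∀ v : sphere (0 : EuclideanSpace ℝ (Fin (m + 2))) 1,
      normalize (v : EuclideanSpace ℝ (Fin (m + 2))) = v := fun v =>
    normalize_eq_self_of_norm_eq_one (norm_eq_of_mem_sphere v)
  have hval : ∀ v : sphere (0 : EuclideanSpace ℝ (Fin (m + 2))) 1,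
      F (fun n => ((update ω k v) n : EuclideanSpace ℝ (Fin (m + 2)))) =
        (fun y : EuclideanSpace ℝ (Fin (m + 2)) =>
          F (update (fun n => (ω n : EuclideanSpace ℝ (Fin (m + 2)))) k (normalize y))) v := by
    intro v
    rw [sphereConfig_update]
    simp only [hν v]
  have hgrad : ∀ v : sphere (0 : EuclideanSpace ℝ (Fin (m + 2))) 1,
      siteGrad k F (fun n => ((update ω k v) n : EuclideanSpace ℝ (Fin (m + 2)))) =
        ∇ (fun y : EuclideanSpace ℝ (Fin (m + 2)) =>
          F (update (fun n => (ω n : EuclideanSpace ℝ (Fin (m + 2)))) k (normalize y))) v := by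
    intro v
    rw [sphereConfig_update, siteGrad]
    simp only [update_idem, update_self]
  simp_rw [hval, hgrad]
  exact h

/-- **THE LATTICE POINCARÉ INEQUALITY** (`m ≥ 2`, `F ∈ C²`, any finite `Λ`):
`(m − 1)·(∫ F² dπ − (∫ F dπ)²) ≤ Σ_k ∫ ‖∂̃_k F‖² dπ`, `π = ⊗_Λ σ̄` — the variance is tensorised
by Efron–Stein and each conditional variance is bounded by the one-site inequality; the constant
does not depend on the number of sites. -/
theorem lattice_sphere_poincare {F : (Λ → EuclideanSpace ℝ (Fin (m + 2))) → ℝ}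
    (hF : ContDiff ℝ 2 F) :
    ((m : ℝ) + 1) * (∫ ω, F (fun n => (ω n : EuclideanSpace ℝ (Fin (m + 2)))) ^ 2
        ∂Measure.pi (fun _ : Λ => uniformSphere (volume : Measure (EuclideanSpace ℝ (Fin (m + 2))))) -
      (∫ ω, F (fun n => (ω n : EuclideanSpace ℝ (Fin (m + 2))))
        ∂Measure.pi (fun _ : Λ => uniformSphere (volume : Measure (EuclideanSpace ℝ (Fin (m + 2)))))) ^ 2) ≤
      ∑ k, ∫ ω, ‖siteGrad k F (fun n => (ω n : EuclideanSpace ℝ (Fin (m + 2))))‖ ^ 2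
        ∂Measure.pi (fun _ : Λ => uniformSphere (volume : Measure (EuclideanSpace ℝ (Fin (m + 2))))) := by
  set μ : Measure (sphere (0 : EuclideanSpace ℝ (Fin (m + 2))) 1) :=
    uniformSphere (volume : Measure (EuclideanSpace ℝ (Fin (m + 2)))) with hμ
  set G : (Λ → sphere (0 : EuclideanSpace ℝ (Fin (m + 2))) 1) → ℝ :=
    fun ω => F (fun n => (ω n : EuclideanSpace ℝ (Fin (m + 2)))) with hG
  have hGc : Continuous G := hF.continuous.comp continuous_sphereConfig
  have hm1 : (0 : ℝ) < (m : ℝ) + 1 := by positivity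
  -- Efron–Stein
  have hES := efronStein μ hGc
  rw [integral_sq_sub_mean μ hGc] at hES
  -- each conditional variance is bounded by the fibre inequality
  have hk : ∀ k, ∫ ω, (G ω - coordAvg μ {k} G ω) ^ 2 ∂Measure.pi (fun _ : Λ => μ) ≤
      ((m : ℝ) + 1)⁻¹ * ∫ ω, ‖siteGrad k F (fun n => (ω n : EuclideanSpace ℝ (Fin (m + 2))))‖ ^ 2
        ∂Measure.pi (fun _ : Λ => μ) := by
    intro k
    rw [integral_sq_sub_coordAvg_singleton μ k hGc]
    -- continuity of the two fibre functionals (as coordinate averages)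
    have hgradc : Continuous fun ω : Λ → sphere (0 : EuclideanSpace ℝ (Fin (m + 2))) 1 =>
        ‖siteGrad k F (fun n => (ω n : EuclideanSpace ℝ (Fin (m + 2))))‖ ^ 2 :=
      ((continuous_siteGrad_sphereConfig (hF.of_le (by norm_num)) k).norm).pow 2
    have h1 : Continuous fun ω : Λ → sphere (0 : EuclideanSpace ℝ (Fin (m + 2))) 1 =>
        ∫ v, G (update ω k v) ^ 2 ∂μ - (∫ v, G (update ω k v) ∂μ) ^ 2 := by
      have hG2 : Continuous fun ω : Λ → sphere (0 : EuclideanSpace ℝ (Fin (m + 2))) 1 => G ω ^ 2 :=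
        hGc.pow 2
      have ha : (fun ω : Λ → sphere (0 : EuclideanSpace ℝ (Fin (m + 2))) 1 =>
          ∫ v, G (update ω k v) ^ 2 ∂μ) = coordAvg μ {k} (fun ω => G ω ^ 2) := by
        funext ω; rw [coordAvg_singleton μ k (G := fun ω => G ω ^ 2) hG2]
      have hb : (fun ω : Λ → sphere (0 : EuclideanSpace ℝ (Fin (m + 2))) 1 =>
          ∫ v, G (update ω k v) ∂μ) = coordAvg μ {k} G := by
        funext ω; rw [coordAvg_singleton μ k hGc]
      have hca := continuous_coordAvg μ {k} (G := fun ω => G ω ^ 2) hG2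
      have hcb := continuous_coordAvg μ {k} hGc
      rw [← ha] at hca
      rw [← hb] at hcb
      exact hca.sub (hcb.pow 2)
    have h2 : Continuous fun ω : Λ → sphere (0 : EuclideanSpace ℝ (Fin (m + 2))) 1 =>
        ∫ v, ‖siteGrad k F (fun n => ((update ω k v) n : EuclideanSpace ℝ (Fin (m + 2))))‖ ^ 2 ∂μ := by
      have ha : (fun ω : Λ → sphere (0 : EuclideanSpace ℝ (Fin (m + 2))) 1 =>
          ∫ v, ‖siteGrad k F (fun n => ((update ω k v) n : EuclideanSpace ℝ (Fin (m + 2))))‖ ^ 2 ∂μ) =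
          coordAvg μ {k} (fun ω => ‖siteGrad k F (fun n => (ω n : EuclideanSpace ℝ (Fin (m + 2))))‖ ^ 2) := by
        funext ω; rw [coordAvg_singleton μ k hgradc]
      rw [ha]; exact continuous_coordAvg μ {k} hgradc
    calc ∫ ω, (∫ v, G (update ω k v) ^ 2 ∂μ - (∫ v, G (update ω k v) ∂μ) ^ 2)
          ∂Measure.pi (fun _ : Λ => μ)
        ≤ ∫ ω, ((m : ℝ) + 1)⁻¹ *
            ∫ v, ‖siteGrad k F (fun n => ((update ω k v) n : EuclideanSpace ℝ (Fin (m + 2))))‖ ^ 2 ∂μ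
            ∂Measure.pi (fun _ : Λ => μ) := by
          refine integral_mono (integrable_pi_of_continuous μ h1)
            (integrable_pi_of_continuous μ (continuous_const.mul h2)) fun ω => ?_
          have hfib := fibre_variance_le hF k ω
          exact (le_inv_mul_iff₀ hm1).2 hfib
      _ = ((m : ℝ) + 1)⁻¹ * ∫ ω, ‖siteGrad k F (fun n => (ω n : EuclideanSpace ℝ (Fin (m + 2))))‖ ^ 2
            ∂Measure.pi (fun _ : Λ => μ) := by
          rw [integral_const_mul]
          congr 1
          have hc := integral_coordAvg μ {k} hgradc
          simp_rw [coordAvg_singleton μ k hgradc] at hc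
          exact hc
  have hsum := Finset.sum_le_sum fun k (_ : k ∈ Finset.univ) => hk k
  rw [← Finset.mul_sum] at hsum
  have htot := hES.trans hsum
  -- multiply through by `m − 1 > 0`
  have := mul_le_mul_of_nonneg_left htot hm1.le
  rwa [← mul_assoc, mul_inv_cancel₀ hm1.ne', one_mul] at this

omit [DecidableEq Λ] in
/-- `⊗_Λ σ̄ = σ(S)^{−|Λ|} • ⊗_Λ σ` (the uniform product measure is a rescaling of the product of
Mathlib's sphere measures). -/
theorem pi_uniformSphere_eq_smul_toSphere :
    (Measure.pi fun _ : Λ => uniformSphere (volume : Measure (EuclideanSpace ℝ (Fin (m + 2))))) =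
      ((((volume : Measure (EuclideanSpace ℝ (Fin (m + 2)))).toSphere univ)⁻¹) ^ Fintype.card Λ) •
        Measure.pi fun _ : Λ => (volume : Measure (EuclideanSpace ℝ (Fin (m + 2)))).toSphere := by
  refine Measure.pi_eq fun s _ => ?_
  rw [Measure.smul_apply, Measure.pi_pi, smul_eq_mul]
  simp only [uniformSphere, Measure.smul_apply, smul_eq_mul]
  rw [Finset.prod_mul_distrib, Finset.prod_const, Finset.card_univ]

omit [DecidableEq Λ] in
/-- Integrals against `⊗_Λ σ̄` are rescaled integrals against `⊗_Λ σ`. -/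
theorem integral_pi_uniformSphere
    (h : (Λ → sphere (0 : EuclideanSpace ℝ (Fin (m + 2))) 1) → ℝ) :
    ∫ ω, h ω ∂Measure.pi (fun _ : Λ => uniformSphere (volume : Measure (EuclideanSpace ℝ (Fin (m + 2))))) =
      (((((volume : Measure (EuclideanSpace ℝ (Fin (m + 2)))).toSphere univ)⁻¹) ^ Fintype.card Λ).toReal) *
        ∫ ω, h ω ∂Measure.pi (fun _ : Λ => (volume : Measure (EuclideanSpace ℝ (Fin (m + 2)))).toSphere) := by
  rw [pi_uniformSphere_eq_smul_toSphere, integral_smul_measure, smul_eq_mul]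

/-- **THE SPECTRAL GAP OF LÜSCHER'S OPERATOR ON THE LATTICE OF SPHERES** (`m ≥ 2`, `F ∈ C²`, any
finite `Λ`): `(m − 1)·(∫ F² dπ − (∫ F dπ)²) ≤ ∫ F·(−Σ_k ∂̃_k·∂̃_k F) dπ` — on functions of mean zero
under the uniform product measure, `⟨F, 𝔏₀F⟩ ≥ (m−1)‖F‖²`: the operator inverted at every order of
Lüscher's construction is bounded below by `d − 1 = 2N − 1`, uniformly in the lattice size. -/
theorem lattice_sphere_spectral_gap {F : (Λ → EuclideanSpace ℝ (Fin (m + 2))) → ℝ}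
    (hF : ContDiff ℝ 2 F) :
    ((m : ℝ) + 1) * (∫ ω, F (fun n => (ω n : EuclideanSpace ℝ (Fin (m + 2)))) ^ 2
        ∂Measure.pi (fun _ : Λ => uniformSphere (volume : Measure (EuclideanSpace ℝ (Fin (m + 2))))) -
      (∫ ω, F (fun n => (ω n : EuclideanSpace ℝ (Fin (m + 2))))
        ∂Measure.pi (fun _ : Λ => uniformSphere (volume : Measure (EuclideanSpace ℝ (Fin (m + 2)))))) ^ 2) ≤
      ∫ ω, F (fun n => (ω n : EuclideanSpace ℝ (Fin (m + 2)))) *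
          -∑ k, siteLaplacian k F (fun n => (ω n : EuclideanSpace ℝ (Fin (m + 2))))
        ∂Measure.pi (fun _ : Λ => uniformSphere (volume : Measure (EuclideanSpace ℝ (Fin (m + 2))))) := by
  have h := lattice_sphere_poincare hF (Λ := Λ)
  have hE : ∫ ω, F (fun n => (ω n : EuclideanSpace ℝ (Fin (m + 2)))) *
        -∑ k, siteLaplacian k F (fun n => (ω n : EuclideanSpace ℝ (Fin (m + 2))))
        ∂Measure.pi (fun _ : Λ => uniformSphere (volume : Measure (EuclideanSpace ℝ (Fin (m + 2))))) =
      ∑ k, ∫ ω, ‖siteGrad k F (fun n => (ω n : EuclideanSpace ℝ (Fin (m + 2))))‖ ^ 2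
        ∂Measure.pi (fun _ : Λ => uniformSphere (volume : Measure (EuclideanSpace ℝ (Fin (m + 2))))) := by
    rw [integral_pi_uniformSphere, integral_mul_neg_sum_siteLaplacian_self hF, Finset.mul_sum]
    refine Finset.sum_congr rfl fun k _ => ?_
    rw [integral_pi_uniformSphere]
  rw [hE]
  exact h

/-- **The gap is attained by site-linear functions**: for `F(x) = ⟪a, x_k⟫`,
`∫ F·(−Σ_j ∂̃_j·∂̃_j F) dπ = (m − 1)·(∫ F² dπ − (∫ F dπ)²)` (`𝔏₀F = (m−1)F` by the one-site
eigenvalue computation, and `∫ F dπ = 0` because the range of `𝔏₀` is orthogonal to constants). -/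
theorem lattice_sphere_spectral_gap_attained (a : EuclideanSpace ℝ (Fin (m + 2))) (k : Λ) :
    ∫ ω, ⟪a, (ω k : EuclideanSpace ℝ (Fin (m + 2)))⟫ *
          -∑ j, siteLaplacian j (fun x : Λ → EuclideanSpace ℝ (Fin (m + 2)) => ⟪a, x k⟫)
            (fun n => (ω n : EuclideanSpace ℝ (Fin (m + 2))))
        ∂Measure.pi (fun _ : Λ => uniformSphere (volume : Measure (EuclideanSpace ℝ (Fin (m + 2))))) =
      ((m : ℝ) + 1) * (∫ ω, ⟪a, (ω k : EuclideanSpace ℝ (Fin (m + 2)))⟫ ^ 2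
        ∂Measure.pi (fun _ : Λ => uniformSphere (volume : Measure (EuclideanSpace ℝ (Fin (m + 2))))) -
      (∫ ω, ⟪a, (ω k : EuclideanSpace ℝ (Fin (m + 2)))⟫
        ∂Measure.pi (fun _ : Λ => uniformSphere (volume : Measure (EuclideanSpace ℝ (Fin (m + 2)))))) ^ 2) := by
  -- `𝔏₀F = (m−1)F` on the product of unit spheres
  have hL : ∀ ω : Λ → sphere (0 : EuclideanSpace ℝ (Fin (m + 2))) 1,
      ∑ j, siteLaplacian j (fun x : Λ → EuclideanSpace ℝ (Fin (m + 2)) => ⟪a, x k⟫)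
        (fun n => (ω n : EuclideanSpace ℝ (Fin (m + 2)))) =
        -(((m : ℝ) + 1) * ⟪a, (ω k : EuclideanSpace ℝ (Fin (m + 2)))⟫) := by
    intro ω
    rw [Finset.sum_eq_single k]
    · have h := siteLaplacian_of_affine (G := fun x : Λ → EuclideanSpace ℝ (Fin (m + 2)) => ⟪a, x k⟫)
        (x := fun n => (ω n : EuclideanSpace ℝ (Fin (m + 2)))) (n := k) (norm_eq_of_mem_sphere (ω k))
        (w := a) (c := 0) (fun y => by simp)
      rw [h, finrank_euclideanSpace, Fintype.card_fin]
      push_cast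
      ring
    · intro j _ hj
      exact siteLaplacian_of_const (c := ⟪a, (ω k : EuclideanSpace ℝ (Fin (m + 2)))⟫)
        fun y => by simp [update_of_ne (Ne.symm hj)]
    · intro h; exact absurd (Finset.mem_univ k) h
  -- `∫ F dπ = 0`
  have hF : ContDiff ℝ 2 (fun x : Λ → EuclideanSpace ℝ (Fin (m + 2)) => ⟪a, x k⟫) :=
    (contDiff_const.inner ℝ (contDiff_apply ℝ (EuclideanSpace ℝ (Fin (m + 2))) k))
  have hmean : ∫ ω, ⟪a, (ω k : EuclideanSpace ℝ (Fin (m + 2)))⟫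
      ∂Measure.pi (fun _ : Λ => uniformSphere (volume : Measure (EuclideanSpace ℝ (Fin (m + 2))))) = 0 := by
    have h0 := integral_sum_siteLaplacian_eq_zero (Λ := Λ) hF
    simp_rw [hL, integral_neg, integral_const_mul] at h0
    have hm1 : ((m : ℝ) + 1) ≠ 0 := by positivity
    have h0' : ∫ ω, ⟪a, (ω k : EuclideanSpace ℝ (Fin (m + 2)))⟫
        ∂Measure.pi (fun _ : Λ => (volume : Measure (EuclideanSpace ℝ (Fin (m + 2)))).toSphere) = 0 := by
      have := neg_eq_zero.1 h0
      exact (mul_eq_zero.1 this).resolve_left hm1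
    rw [integral_pi_uniformSphere, h0', mul_zero]
  simp_rw [hL, hmean]
  simp only [neg_neg, zero_pow two_ne_zero, sub_zero]
  rw [← integral_const_mul]
  refine integral_congr_ae (ae_of_all _ fun ω => ?_)
  ring

end Lattice

end Summit.Ventures.LatticeQCDFlow.Exactness

end
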